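import Literature.NumberTheory.EllipticCurves.AnalyticIsogenyDescentProofs
import Literature.NumberTheory.EllipticCurves.NeronIsogenyScaling
import HarnessLib

/-!
# The rational scaling `q` of `qΛ₀ ⊆ Λ'` is the multiplier of an explicit `ℚ`-isogeny:
# the archimedean half of `integral_neronScaling_of_isGloballyMinimal`

Topic `NumberTheory/EllipticCurves`; a proofs-only sibling (theorems only: no definitions, no
named facts) of `NeronIsogenyScaling.lean`, whose named fact
`Literature.NumberTheory.EllipticCurves.integral_neronScaling_of_isGloballyMinimal` (for globally
minimal `W₀, W'/ℚ` with Néron-type period pairs `L₀, L'` and `q ∈ ℚ` with `qΛ₀ ⊆ Λ'`, `q ∈ ℤ`)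
splits into

* (archimedean / algebraic) `q ≠ 0` is the **multiplier of a `ℚ`-isogeny** `φ : W₀ → W'`: off a
  finite set of `ℚ̄`-points, `x(φ(x, y)) = A(x)/B(x)` with `A, B ∈ ℚ[X]`, `B` monic,
  `deg A = deg B + 1` and leading coefficient `lc(A) = q⁻²` — i.e. `x ∘ φ = q⁻²x + O(1)` at `O`,
  which in terms of the invariant differentials `ω = dx/(2y + a₁x + a₃)` is `φ^*ω' = ±q·ω₀`
  (Silverman, *AEC*, Thm. VI.4.1(b): `Hom(E₁, E₂) ≅ {α : αΛ₁ ⊆ Λ₂}`, the isogeny `[α]` being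
  `z ↦ αz`, whose `x`-coordinate is `℘_{Λ₂}(αz) = α⁻²℘_{α⁻¹Λ₂}(z) = α⁻²·T(℘_{Λ₁}(z))` with
  `T = P/Q`, `deg P = deg Q + 1`, `lc P = lc Q`);
* (finite places) the multiplier of a `ℚ`-isogeny between globally minimal models is an integer
  (Néron mapping property, Silverman *ATAEC* IV.5–6 with Cor. IV.9.1; NOT proved in the tree — it
  needs Tate's algorithm / Néron models, see the module docstring of `NeronIsogenyScaling.lean`).

This file PROVES the first half, in three layers:

* `PeriodPair.natDegree_eq_succ_of_weierstrassP_mul_eval_eq` — for lattices `Λ ⊆ Λ'` and a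
  transformation `℘_{Λ'}·Q(℘_Λ) = P(℘_Λ)` (`Q ≠ 0`), **`deg P = deg Q + 1` and `lc P = lc Q`**:
  compare degrees and leading coefficients in the algebraic certificate
  `(P′Q − PQ′)²·(4X³ − g₂X − g₃) = Q·(4P³ − g₂′PQ² − g₃′Q³)` of the tree
  (`PeriodPair.transformation_polynomial_identity`), using `deg Q < deg P`
  (`PeriodPair.natDegree_lt_of_weierstrassP_mul_eval_eq`); analytically: `T(x) = x + O(1)` as
  `x → ∞` because `℘_{Λ'}(z) − ℘_Λ(z)` is bounded near `z = 0`.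
* `PeriodPair.exists_rat_transformation_of_forall_mul_mem_lattice` — for lattices with rational
  invariants and `q ∈ ℚˣ` with `qΛ ⊆ Λ'`: `q²℘_{Λ'}(qz)·Q₀(℘_Λ z) = P₀(℘_Λ z)` with
  `P₀, Q₀ ∈ ℚ[X]` coprime, `Q₀` monic, `deg P₀ = deg Q₀ + 1`, `lc P₀ = 1` (the tree's
  `exists_rat_polynomial_weierstrassP_mul_eval_eq_of_le` for `Λ ⊆ q⁻¹Λ'` and homogeneity of `℘`).
* `Literature.NumberTheory.EllipticCurves.exists_isogeny_x_eq_of_forall_mul_mem_lattice` — for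
  Weierstrass models `W₁, W₂/ℚ` (`W₁` elliptic) with Néron-type period pairs and `c ∈ ℚˣ` with
  `cΛ₁ ⊆ Λ₂`: an isogeny `φ : W₁ → W₂` over `ℚ` (the tree's `WeierstrassCurve.Isogeny`) together
  with `A, B ∈ ℚ[X]` as in the first bullet and the explicit formula for `x ∘ φ` off a finite set.
  The construction is that of the tree's `isIsogenous_of_forall_mul_mem_lattice`
  (`AnalyticIsogenyDescentProofs`, which only records `IsIsogenous W₁ W₂`), re-run with the
  coordinate formula `map_some_eq_uniformize_mul_of_transformation` exported;
  `exists_isogeny_x_eq_of_isNeronLatticeOf` is the specialisation to the hypotheses of the fact.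

Not here: the finite-place half (integrality of the multiplier), hence no proof of the fact.

## References

* [SilvermanAEC2009] J. H. Silverman, *The Arithmetic of Elliptic Curves*, 2nd ed., GTM 106,
  Springer 2009: Thm. VI.4.1(b), Prop. VI.3.6, III.4, III.5.
* [SilvermanATAEC1994] J. H. Silverman, *Advanced Topics in the Arithmetic of Elliptic Curves*,
  GTM 151, Springer 1994: IV.5 (Néron mapping property, PDF p. 299), Thm. IV.6.1, Cor. IV.9.1.
-/

noncomputable section

open scoped Classical
open Complex Set Polynomial Filter Topology Bornology
open Literature.NumberTheory.EllipticCurves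

namespace PeriodPair

variable (L L' : PeriodPair)

/-! ### Leading behaviour of a transformation: `T(x) = x + O(1)` -/

/-- **`deg P = deg Q + 1` and `lc P = lc Q` for the transformation `℘_{Λ'} = (P/Q)(℘_Λ)` of a
lattice inclusion `Λ ⊆ Λ'`.** If `℘_{Λ'}(z)·Q(℘_Λ z) = P(℘_Λ z)` for all `z ∉ Λ'` with `Q ≠ 0`,
then `P.natDegree = Q.natDegree + 1` and `P.leadingCoeff = Q.leadingCoeff`, i.e. `T = P/Q`
satisfies `T(x) = x + O(1)` (`x → ∞`): the isogeny `z ↦ z`, `ℂ/Λ → ℂ/Λ'` pulls `dx'/y'` back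
to `dx/y` (Silverman, *AEC*, Thm. VI.4.1(b) with III.5). Proof: in the certificate
`(P′Q − PQ′)²·(4X³ − g₂X − g₃) = Q·(4P³ − g₂′PQ² − g₃′Q³)`
(`transformation_polynomial_identity`) the left side has degree `2(d + e − 1) + 3` and leading
coefficient `4(d − e)²a²b²`, the right side degree `3d + e` and leading coefficient `4a³b`
(`d = deg P > e = deg Q` by `natDegree_lt_of_weierstrassP_mul_eval_eq`, `a = lc P`,
`b = lc Q`), whence `d = e + 1` and `b = a`. [cite: SilvermanAEC2009, Thm. VI.4.1] -/
theorem natDegree_eq_succ_of_weierstrassP_mul_eval_eq {P Q : ℂ[X]}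
    (h : L.lattice ≤ L'.lattice) (hQ0 : Q ≠ 0)
    (hPQ : ∀ z ∉ L'.lattice, ℘[L'] z * Q.eval (℘[L] z) = P.eval (℘[L] z)) :
    P.natDegree = Q.natDegree + 1 ∧ P.leadingCoeff = Q.leadingCoeff := by
  have hlt : Q.natDegree < P.natDegree := L.natDegree_lt_of_weierstrassP_mul_eval_eq L' hQ0 hPQ
  have hid := L.transformation_polynomial_identity L' h hPQ
  set d := P.natDegree with hd
  set e := Q.natDegree with he
  set a := P.leadingCoeff with ha
  set b := Q.leadingCoeff with hb
  have hP0 : P ≠ 0 := by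
    rintro rfl
    simp [hd] at hlt
  have ha0 : a ≠ 0 := leadingCoeff_ne_zero.mpr hP0
  have hb0 : b ≠ 0 := leadingCoeff_ne_zero.mpr hQ0
  have hd1 : 1 ≤ d := by omega
  -- the Wronskian `D = P′Q − PQ′` has degree `d + e − 1` and leading coefficient `(d − e)ab`
  set D : ℂ[X] := derivative P * Q - P * derivative Q with hD
  have hPc : P.coeff d = a := rfl
  have hQc : Q.coeff e = b := rfl
  have hDcoeff : D.coeff (d - 1 + e) = ((d : ℂ) - e) * a * b := by
    have h1 : (derivative P * Q).coeff (d - 1 + e) = a * d * b := by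
      have hcd : ((P.natDegree - 1 : ℕ) : ℂ) = (d : ℂ) - 1 := by
        rw [← hd, Nat.cast_sub hd1, Nat.cast_one]
      rw [coeff_mul_add_eq_of_natDegree_le (natDegree_derivative_le P) le_rfl, coeff_derivative,
        Nat.sub_add_cancel hd1, hPc, hQc, hcd]
      ring
    have h2 : (P * derivative Q).coeff (d - 1 + e) = a * (b * e) := by
      rcases Nat.eq_zero_or_pos e with he0 | he0
      · have hQ' : derivative Q = 0 := by
          rw [eq_C_of_natDegree_eq_zero he0, derivative_C]
        simp [hQ', he0]
      · have hidx : d - 1 + e = d + (e - 1) := by omega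
        have hce : ((Q.natDegree - 1 : ℕ) : ℂ) = (e : ℂ) - 1 := by
          rw [← he, Nat.cast_sub he0, Nat.cast_one]
        rw [hidx, coeff_mul_add_eq_of_natDegree_le le_rfl (natDegree_derivative_le Q),
          coeff_derivative, Nat.sub_add_cancel he0, hPc, hQc, hce]
        ring
    rw [hD, coeff_sub, h1, h2]
    ring
  have hDle : D.natDegree ≤ d - 1 + e := by
    refine (natDegree_sub_le _ _).trans (max_le ?_ ?_)
    · exact (natDegree_mul_le).trans (Nat.add_le_add_right (natDegree_derivative_le P) _)
    · rcases Nat.eq_zero_or_pos e with he0 | he0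
      · have hQ' : derivative Q = 0 := by
          rw [eq_C_of_natDegree_eq_zero he0, derivative_C]
        simp [hQ']
      · refine (natDegree_mul_le).trans ?_
        have := natDegree_derivative_le Q
        omega
  have hde : ((d : ℂ) - e) ≠ 0 := by
    rw [sub_ne_zero]
    exact_mod_cast hlt.ne'
  have hDc0 : D.coeff (d - 1 + e) ≠ 0 := by
    rw [hDcoeff]
    exact mul_ne_zero (mul_ne_zero hde ha0) hb0
  have hDdeg : D.natDegree = d - 1 + e := natDegree_eq_of_le_of_coeff_ne_zero hDle hDc0
  have hDlc : D.leadingCoeff = ((d : ℂ) - e) * a * b := by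
    rw [leadingCoeff, hDdeg, hDcoeff]
  have hD0 : D ≠ 0 := fun h0 ↦ hDc0 (by rw [h0, coeff_zero])
  -- the cubic `F = 4X³ − g₂X − g₃`
  set F : ℂ[X] := 4 * X ^ 3 - C L.g₂ * X - C L.g₃ with hF
  have h40 : (4 : ℂ) ≠ 0 := by norm_num
  have hC4 : (C (4 : ℂ) : ℂ[X]) = 4 := map_ofNat C 4
  have hF' : F = C 4 * X ^ 3 + C 0 * X ^ 2 + C (-L.g₂) * X + C (-L.g₃) := by
    rw [hF, hC4, map_zero, zero_mul, add_zero, map_neg, map_neg]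
    ring
  have hFdeg : F.natDegree = 3 := by rw [hF']; exact natDegree_cubic h40
  have hFlc : F.leadingCoeff = 4 := by rw [hF']; exact leadingCoeff_cubic h40
  have hF0 : F ≠ 0 := fun h0 ↦ by simp [h0] at hFlc
  -- the right-hand cubic `G = 4P³ − g₂′PQ² − g₃′Q³`
  set G : ℂ[X] := 4 * P ^ 3 - C L'.g₂ * P * Q ^ 2 - C L'.g₃ * Q ^ 3 with hG
  have hP3deg : (4 * P ^ 3 : ℂ[X]).natDegree = 3 * d := by
    rw [← hC4, natDegree_C_mul h40, natDegree_pow]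
  have hP3lc : (4 * P ^ 3 : ℂ[X]).leadingCoeff = 4 * a ^ 3 := by
    rw [← hC4, leadingCoeff_mul, leadingCoeff_C, leadingCoeff_pow]
  have h2deg : (C L'.g₂ * P * Q ^ 2).natDegree < 3 * d := by
    refine lt_of_le_of_lt (natDegree_mul_le.trans (Nat.add_le_add (natDegree_C_mul_le _ _)
      natDegree_pow_le)) ?_
    show d + 2 * e < 3 * d
    omega
  have h3deg : (C L'.g₃ * Q ^ 3).natDegree < 3 * d := by
    refine lt_of_le_of_lt ((natDegree_C_mul_le _ _).trans natDegree_pow_le) ?_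
    show 3 * e < 3 * d
    omega
  have hG1deg : (4 * P ^ 3 - C L'.g₂ * P * Q ^ 2 : ℂ[X]).natDegree = 3 * d := by
    rw [natDegree_sub_eq_left_of_natDegree_lt (h2deg.trans_eq hP3deg.symm), hP3deg]
  have hG1lc : (4 * P ^ 3 - C L'.g₂ * P * Q ^ 2 : ℂ[X]).leadingCoeff = 4 * a ^ 3 := by
    rw [leadingCoeff_sub_of_degree_lt (degree_lt_degree (h2deg.trans_eq hP3deg.symm)), hP3lc]
  have hGdeg : G.natDegree = 3 * d := by
    rw [hG, natDegree_sub_eq_left_of_natDegree_lt (h3deg.trans_eq hG1deg.symm), hG1deg]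
  have hGlc : G.leadingCoeff = 4 * a ^ 3 := by
    rw [hG, leadingCoeff_sub_of_degree_lt (degree_lt_degree (h3deg.trans_eq hG1deg.symm)), hG1lc]
  have hG0 : G ≠ 0 := fun h0 ↦ by
    have : (4 : ℂ) * a ^ 3 = 0 := by rw [← hGlc, h0, leadingCoeff_zero]
    exact (mul_ne_zero h40 (pow_ne_zero 3 ha0)) this
  -- compare degrees and leading coefficients in `D² F = Q G`
  have hdegL : (D ^ 2 * F).natDegree = 2 * (d - 1 + e) + 3 := by
    rw [natDegree_mul (pow_ne_zero 2 hD0) hF0, natDegree_pow, hDdeg, hFdeg]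
  have hdegR : (Q * G).natDegree = e + 3 * d := by
    rw [natDegree_mul hQ0 hG0, hGdeg]
  have hlcL : (D ^ 2 * F).leadingCoeff = (((d : ℂ) - e) * a * b) ^ 2 * 4 := by
    rw [leadingCoeff_mul, leadingCoeff_pow, hDlc, hFlc]
  have hlcR : (Q * G).leadingCoeff = b * (4 * a ^ 3) := by
    rw [leadingCoeff_mul, hGlc]
  have hdeq : d = e + 1 := by
    have := congrArg natDegree hid
    rw [hdegL, hdegR] at this
    omega
  refine ⟨hdeq, ?_⟩
  have hlc := congrArg leadingCoeff hid
  rw [hlcL, hlcR, hdeq] at hlc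
  push_cast at hlc
  have h' : a ^ 2 * b * (b - a) * 4 = 0 := by linear_combination hlc
  rcases mul_eq_zero.mp h' with h'' | h''
  · rcases mul_eq_zero.mp h'' with h3 | h3
    · exact absurd h3 (mul_ne_zero (pow_ne_zero 2 ha0) hb0)
    · exact (sub_eq_zero.mp h3).symm
  · exact absurd h'' h40

/-! ### The transformation attached to `qΛ ⊆ Λ'`, over `ℚ`, with its leading behaviour -/

/-- **The `x`-coordinate of the analytic isogeny `z ↦ qz`.** Let `Λ, Λ'` be lattices with
rational invariants `g₂, g₃, g₂′, g₃′` and `q ∈ ℚˣ` with `qΛ ⊆ Λ'`. Then there are coprime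
`P₀, Q₀ ∈ ℚ[X]`, `Q₀` monic, with **`deg P₀ = deg Q₀ + 1` and `lc P₀ = 1`**, `Q₀(℘_Λ z) ≠ 0` and
`q²·℘_{Λ'}(qz)·Q₀(℘_Λ z) = P₀(℘_Λ z)` whenever `qz ∉ Λ'`. In other words the `x`-coordinate
`℘_{Λ'}(qz)` of `z ↦ qz : ℂ/Λ → ℂ/Λ'` is `q⁻²·T(℘_Λ z)` with `T = P₀/Q₀ ∈ ℚ(X)`,
`T(x) = x + O(1)` (Silverman, *AEC*, Thm. VI.4.1(b); the tree's
`exists_rat_polynomial_weierstrassP_mul_eval_eq_of_le` applied to `Λ ⊆ q⁻¹Λ'`, whose invariants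
`q⁴g₂′, q⁶g₃′` are rational, the homogeneity `℘_{q⁻¹Λ'}(z) = q²℘_{Λ'}(qz)`, and
`natDegree_eq_succ_of_weierstrassP_mul_eval_eq`). [cite: SilvermanAEC2009, Thm. VI.4.1] -/
theorem exists_rat_transformation_of_forall_mul_mem_lattice
    (h₂ : ∃ r : ℚ, (r : ℂ) = L.g₂) (h₃ : ∃ r : ℚ, (r : ℂ) = L.g₃)
    (h₂' : ∃ r : ℚ, (r : ℂ) = L'.g₂) (h₃' : ∃ r : ℚ, (r : ℂ) = L'.g₃) {q : ℚ} (hq : q ≠ 0)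
    (hle : ∀ z ∈ L.lattice, (q : ℂ) * z ∈ L'.lattice) :
    ∃ P₀ Q₀ : ℚ[X], Q₀.Monic ∧ IsCoprime P₀ Q₀ ∧ P₀.natDegree = Q₀.natDegree + 1 ∧
      P₀.leadingCoeff = 1 ∧
      (∀ z : ℂ, (q : ℂ) * z ∉ L'.lattice → (Q₀.map (algebraMap ℚ ℂ)).eval (℘[L] z) ≠ 0) ∧
      ∀ z : ℂ, (q : ℂ) * z ∉ L'.lattice →
        (q : ℂ) ^ 2 * ℘[L'] (q * z) * (Q₀.map (algebraMap ℚ ℂ)).eval (℘[L] z) =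
          (P₀.map (algebraMap ℚ ℂ)).eval (℘[L] z) := by
  have hqC : (q : ℂ) ≠ 0 := by exact_mod_cast hq
  have hqi : (q : ℂ)⁻¹ ≠ 0 := inv_ne_zero hqC
  -- the lattice `Λ'' = q⁻¹Λ' ⊇ Λ`
  set L'' : PeriodPair := L'.mulLeft ((q : ℂ)⁻¹) hqi with hL''def
  have hL'' : ∀ z, z ∈ L''.lattice ↔ (q : ℂ) * z ∈ L'.lattice := fun z ↦ by
    rw [hL''def, PeriodPair.mem_mulLeft_lattice, inv_inv]
  have hLL'' : L.lattice ≤ L''.lattice := fun z hz ↦ (hL'' z).mpr (hle z hz)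
  have h℘ : ∀ z, ℘[L''] z = (q : ℂ) ^ 2 * ℘[L'] (q * z) := fun z ↦ by
    have h := PeriodPair.weierstrassP_mulLeft ((q : ℂ)⁻¹) hqi L' (q * z)
    rw [inv_mul_cancel_left₀ hqC, ← hL''def] at h
    rw [h, inv_pow, inv_inv]
  obtain ⟨r₂, hr₂⟩ := h₂'
  obtain ⟨r₃, hr₃⟩ := h₃'
  have hg₂'' : ∃ r : ℚ, (r : ℂ) = L''.g₂ :=
    ⟨q ^ 4 * r₂, by rw [hL''def, PeriodPair.g₂_mulLeft, ← hr₂, inv_pow, inv_inv]; push_cast; ring⟩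
  have hg₃'' : ∃ r : ℚ, (r : ℂ) = L''.g₃ :=
    ⟨q ^ 6 * r₃, by rw [hL''def, PeriodPair.g₃_mulLeft, ← hr₃, inv_pow, inv_inv]; push_cast; ring⟩
  obtain ⟨P₀, Q₀, hQ₀m, hcop, hQ, hPQ⟩ :=
    L.exists_rat_polynomial_weierstrassP_mul_eval_eq_of_le L'' hLL'' h₂ h₃ hg₂'' hg₃''
  have hQ0 : Q₀.map (algebraMap ℚ ℂ) ≠ 0 := (hQ₀m.map _).ne_zero
  obtain ⟨hdeg, hlc⟩ := L.natDegree_eq_succ_of_weierstrassP_mul_eval_eq L'' hLL'' hQ0 hPQ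
  rw [natDegree_map, natDegree_map] at hdeg
  rw [leadingCoeff_map, leadingCoeff_map, hQ₀m.leadingCoeff, map_one] at hlc
  refine ⟨P₀, Q₀, hQ₀m, hcop, hdeg, ?_, fun z hz ↦ hQ z (fun h ↦ hz ((hL'' z).mp h)),
    fun z hz ↦ ?_⟩
  · exact (algebraMap ℚ ℂ).injective (by rw [hlc, map_one])
  · rw [← h℘]
    exact hPQ z (fun h ↦ hz ((hL'' z).mp h))

end PeriodPair

namespace Literature.NumberTheory.EllipticCurves

open _root_.WeierstrassCurve _root_.PeriodPair

/-! ### The explicit `ℚ`-isogeny attached to `cΛ₁ ⊆ Λ₂` -/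

/-- **The analytic isogeny `z ↦ cz` is a `ℚ`-isogeny whose `x`-coordinate is
`c⁻²x + O(1)`.** Let `W₁, W₂` be Weierstrass models over `ℚ` (`W₁` elliptic) with Néron-type
period pairs `L₁, L₂` (`g₂ = c₄/12`, `g₃ = c₆/216`) and `c ∈ ℚˣ` with `cΛ₁ ⊆ Λ₂`. Then there is
an isogeny `φ : W₁ → W₂` defined over `ℚ` (the tree's `WeierstrassCurve.Isogeny`: additive on
`ℚ̄`-points, algebraic off a finite set, `Γ_ℚ`-equivariant, finite kernel), polynomials
`A, B ∈ ℚ[X]` with `B` monic, `deg A = deg B + 1`, `lc A = c⁻²`, and a finite set `Bad` of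
`ℚ̄`-points off which `x(φ(x, y)) = A(x)/B(x)` (`B(x) ≠ 0`). Here `φ` is the map
`u₁(z) ↦ u₂(cz)` for the uniformisations `uᵢ : ℂ/Λᵢ ≅ Wᵢ(ℂ)` (Silverman, *AEC*, VI.3.6,
Thm. VI.4.1(b)), `A/B = c⁻²·(P₀/Q₀)(X + b₂/12) − b₂′/12` for the rational transformation
`℘_{c⁻¹Λ₂} = (P₀/Q₀)(℘_{Λ₁})` (`PeriodPair.exists_rat_polynomial_weierstrassP_mul_eval_eq_of_le`)
whose leading behaviour is `PeriodPair.natDegree_eq_succ_of_weierstrassP_mul_eval_eq`; in terms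
of invariant differentials, `φ^*(dx′/(2y′ + a₁′x′ + a₃′)) = ±c·dx/(2y + a₁x + a₃)` (AEC III.5).
The construction (uniformisations, descent of the transformation to `ℚ(X)`, algebraicity,
`Γ_ℚ`-equivariance) is verbatim that of the tree's `isIsogenous_of_forall_mul_mem_lattice`
(`AnalyticIsogenyDescentProofs`), which records only `IsIsogenous W₁ W₂`; new are the exported
formula and the degree / leading-coefficient bookkeeping. [cite: SilvermanAEC2009, Thm. VI.4.1] -/
theorem exists_isogeny_x_eq_of_forall_mul_mem_lattice {W₁ W₂ : WeierstrassCurve ℚ} [W₁.IsElliptic]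
    {L₁ L₂ : PeriodPair} (h₁₂ : L₁.g₂ = (W₁.baseChange ℂ).c₄ / 12)
    (h₁₃ : L₁.g₃ = (W₁.baseChange ℂ).c₆ / 216) (h₂₂ : L₂.g₂ = (W₂.baseChange ℂ).c₄ / 12)
    (h₂₃ : L₂.g₃ = (W₂.baseChange ℂ).c₆ / 216) {c : ℚ} (hc : c ≠ 0)
    (hle : ∀ z ∈ L₁.lattice, (c : ℂ) * z ∈ L₂.lattice) :
    ∃ (φ : Isogeny W₁ W₂) (A B : ℚ[X]) (Bad : Set W₁.geomPoints), Bad.Finite ∧ B.Monic ∧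
      A.natDegree = B.natDegree + 1 ∧ A.leadingCoeff = c⁻¹ ^ 2 ∧
      ∀ (x y : AlgebraicClosure ℚ)
        (h : (W₁.baseChange (AlgebraicClosure ℚ)).toAffine.Nonsingular x y),
        (Affine.Point.some x y h : W₁.geomPoints) ∉ Bad →
        aeval x B ≠ 0 ∧ ∃ (y₂ : AlgebraicClosure ℚ)
          (h₂ : (W₂.baseChange (AlgebraicClosure ℚ)).toAffine.Nonsingular (aeval x A / aeval x B) y₂),
          φ (Affine.Point.some x y h) = Affine.Point.some (aeval x A / aeval x B) y₂ h₂ := by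
  -- the uniformisations `uᵢ : ℂ/Λᵢ ≅ Wᵢ(ℂ)`
  obtain ⟨u₁, hker₁, hsurj₁, hu₁⟩ := L₁.exists_addMonoidHom_of_g₂_g₃' h₁₂ h₁₃
  obtain ⟨u₂, hker₂, -, hu₂⟩ := L₂.exists_addMonoidHom_of_g₂_g₃' h₂₂ h₂₃
  have hu₁0 : ∀ z, u₁ z = 0 ↔ z ∈ L₁.lattice := fun z ↦ by
    rw [← SetLike.mem_coe, ← hker₁, SetLike.mem_coe, AddMonoidHom.mem_ker]
  have hu₂0 : ∀ z, u₂ z = 0 ↔ z ∈ L₂.lattice := fun z ↦ by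
    rw [← SetLike.mem_coe, ← hker₂, SetLike.mem_coe, AddMonoidHom.mem_ker]
  -- the lattice `Λ' = c⁻¹Λ₂ ⊇ Λ₁`
  have hcC : (c : ℂ) ≠ 0 := by exact_mod_cast hc
  have hci : (c : ℂ)⁻¹ ≠ 0 := inv_ne_zero hcC
  set L' : PeriodPair := L₂.mulLeft ((c : ℂ)⁻¹) hci with hL'def
  have hL' : ∀ z, z ∈ L'.lattice ↔ (c : ℂ) * z ∈ L₂.lattice := fun z ↦ by
    rw [hL'def, PeriodPair.mem_mulLeft_lattice, inv_inv]
  have hLL' : L₁.lattice ≤ L'.lattice := fun z hz ↦ (hL' z).mpr (hle z hz)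
  have h℘ : ∀ z, ℘[L₂] (c * z) = ((c : ℂ)⁻¹) ^ 2 * ℘[L'] z := fun z ↦ by
    have h := PeriodPair.weierstrassP_mulLeft ((c : ℂ)⁻¹) hci L₂ (c * z)
    rw [inv_mul_cancel_left₀ hcC, ← hL'def] at h
    rw [h, ← mul_assoc, mul_inv_cancel₀ (pow_ne_zero 2 hci), one_mul]
  have h℘' : ∀ z, ℘'[L₂] (c * z) = ((c : ℂ)⁻¹) ^ 3 * ℘'[L'] z := fun z ↦ by
    have h := PeriodPair.derivWeierstrassP_mulLeft ((c : ℂ)⁻¹) hci L₂ (c * z)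
    rw [inv_mul_cancel_left₀ hcC, ← hL'def] at h
    rw [h, ← mul_assoc, mul_inv_cancel₀ (pow_ne_zero 3 hci), one_mul]
  -- the invariants are rational
  have hg₂ : ∃ q : ℚ, (q : ℂ) = L₁.g₂ :=
    ⟨W₁.c₄ / 12, by rw [h₁₂, WeierstrassCurve.baseChange, WeierstrassCurve.map_c₄, eq_ratCast]; push_cast; ring⟩
  have hg₃ : ∃ q : ℚ, (q : ℂ) = L₁.g₃ :=
    ⟨W₁.c₆ / 216, by rw [h₁₃, WeierstrassCurve.baseChange, WeierstrassCurve.map_c₆, eq_ratCast]; push_cast; ring⟩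
  have hg₂' : ∃ q : ℚ, (q : ℂ) = L'.g₂ :=
    ⟨c ^ 4 * W₂.c₄ / 12, by
      rw [hL'def, PeriodPair.g₂_mulLeft, h₂₂, WeierstrassCurve.baseChange, WeierstrassCurve.map_c₄,
        eq_ratCast, inv_pow, inv_inv]; push_cast; ring⟩
  have hg₃' : ∃ q : ℚ, (q : ℂ) = L'.g₃ :=
    ⟨c ^ 6 * W₂.c₆ / 216, by
      rw [hL'def, PeriodPair.g₃_mulLeft, h₂₃, WeierstrassCurve.baseChange, WeierstrassCurve.map_c₆,
        eq_ratCast, inv_pow, inv_inv]; push_cast; ring⟩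
  -- the transformation `℘_{Λ'} = (P₀/Q₀)(℘_{Λ₁})` over `ℚ`, and its derivative
  obtain ⟨P₀, Q₀, hQ₀m, -, hQ', hPQ'⟩ :=
    L₁.exists_rat_polynomial_weierstrassP_mul_eval_eq_of_le L' hLL' hg₂ hg₃ hg₂' hg₃'
  -- NEW (relative to `isIsogenous_of_forall_mul_mem_lattice`): the leading behaviour of `P₀/Q₀`
  obtain ⟨hdegPQ, hlcPQ⟩ := L₁.natDegree_eq_succ_of_weierstrassP_mul_eval_eq L' hLL'
    (hQ₀m.map (algebraMap ℚ ℂ)).ne_zero hPQ'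
  rw [natDegree_map, natDegree_map] at hdegPQ
  rw [leadingCoeff_map, leadingCoeff_map, hQ₀m.leadingCoeff, map_one] at hlcPQ
  replace hlcPQ : P₀.leadingCoeff = 1 := (algebraMap ℚ ℂ).injective (by rw [hlcPQ, map_one])
  have hQ : ∀ z ∉ L'.lattice, aeval (℘[L₁] z) Q₀ ≠ 0 := fun z hz ↦ by
    rw [← eval_map_algebraMap]; exact hQ' z hz
  have hPQ : ∀ z ∉ L'.lattice, ℘[L'] z * aeval (℘[L₁] z) Q₀ = aeval (℘[L₁] z) P₀ := fun z hz ↦ by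
    rw [← eval_map_algebraMap, ← eval_map_algebraMap]; exact hPQ' z hz
  have hder : ∀ z ∉ L'.lattice, ℘'[L'] z * aeval (℘[L₁] z) Q₀ ^ 2 =
      ℘'[L₁] z * aeval (℘[L₁] z) (derivative P₀ * Q₀ - P₀ * derivative Q₀) := fun z hz ↦ by
    have h := L₁.derivWeierstrassP_mul_eval_sq_eq_of_le L' hLL' hPQ' hz
    rw [Polynomial.derivative_map, Polynomial.derivative_map, ← Polynomial.map_mul,
      ← Polynomial.map_mul, ← Polynomial.map_sub, eval_map_algebraMap, eval_map_algebraMap] at h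
    exact h
  -- freeze the numerator of the derivative of the transformation
  set N₀ : ℚ[X] := derivative P₀ * Q₀ - P₀ * derivative Q₀ with hN₀
  -- an embedding `j : ℚ̄ → ℂ` and the induced injections on points
  haveI hQbar : Algebra.IsAlgebraic ℚ (AlgebraicClosure ℚ) := AlgebraicClosure.isAlgebraic ℚ
  obtain ⟨j⟩ : Nonempty ((AlgebraicClosure ℚ) →ₐ[ℚ] ℂ) := ⟨IsAlgClosed.lift⟩
  set jW₁ := (Affine.Point.map (W' := W₁) j : W₁.geomPoints →+ (W₁.baseChange ℂ).toAffine.Point)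
    with hjW₁
  set jW₂ := (Affine.Point.map (W' := W₂) j : W₂.geomPoints →+ (W₂.baseChange ℂ).toAffine.Point)
    with hjW₂
  have hj₁ : Function.Injective jW₁ := Affine.Point.map_injective (W' := W₁) j
  have hj₂ : Function.Injective jW₂ := Affine.Point.map_injective (W' := W₂) j
  -- the analytic isogeny `Φ : W₁(ℂ) → W₂(ℂ)`, `u₁ z ↦ u₂ (cz)`
  obtain ⟨Φ, hΦ⟩ : ∃ Φ : (W₁.baseChange ℂ).toAffine.Point →+ (W₂.baseChange ℂ).toAffine.Point,
      ∀ z, Φ (u₁ z) = u₂ (c * z) := by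
    refine exists_addMonoidHom_apply_eq u₁ hsurj₁ (u₂.comp (AddMonoidHom.mulLeft (c : ℂ)))
      fun z hz ↦ ?_
    rw [AddMonoidHom.coe_comp, Function.comp_apply, AddMonoidHom.coe_mulLeft, hu₂0]
    exact hle z ((hu₁0 z).mp hz)
  -- representatives of `Λ'/Λ₁` and the finite exceptional set
  obtain ⟨S, hS0, -, hS, -⟩ := L₁.exists_finset_representatives L' hLL'
  have hkerΦ : ∀ z, Φ (u₁ z) = 0 → u₁ z ∈ u₁ '' (S : Set ℂ) := by
    intro z hz
    rw [hΦ, hu₂0, ← hL'] at hz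
    obtain ⟨s, hs, hzs⟩ := (hS z).mp hz
    refine ⟨s, hs, ?_⟩
    have h0 : u₁ (z - s) = 0 := (hu₁0 _).mpr hzs
    rwa [map_sub, sub_eq_zero, eq_comm] at h0
  set β₁ : (AlgebraicClosure ℚ) := algebraMap ℚ (AlgebraicClosure ℚ) W₁.b₂ / 12 with hβ₁
  set Bad : Set W₁.geomPoints := {m | jW₁ m ∈ u₁ '' (S : Set ℂ)} ∪
    {m | ∃ (x y : (AlgebraicClosure ℚ)) (h : (W₁.baseChange (AlgebraicClosure ℚ)).toAffine.Nonsingular x y),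
      m = .some x y h ∧ ((Q₀.map (algebraMap ℚ (AlgebraicClosure ℚ))).comp (X + C β₁)).eval x = 0} with hBad
  have hBadfin : Bad.Finite := by
    refine Set.Finite.union ?_ ?_
    · exact (S.finite_toSet.image u₁).preimage hj₁.injOn
    · refine finite_setOf_eval_x_eq_zero W₁ (Monic.ne_zero ?_)
      exact (hQ₀m.map _).comp (monic_X_add_C β₁) (by rw [natDegree_X_add_C]; exact one_ne_zero)
  have hevalQ : ∀ x : (AlgebraicClosure ℚ), ((Q₀.map (algebraMap ℚ (AlgebraicClosure ℚ))).comp (X + C β₁)).eval x = aeval (x + β₁) Q₀ := by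
    intro x
    rw [eval_comp, eval_add, eval_X, eval_C, eval_map_algebraMap]
  -- good points: affine, `Q₀(x + β₁) ≠ 0`, and `j m = u₁ z` with `z ∉ Λ'`
  have hgood : ∀ m : W₁.geomPoints, m ∉ Bad → ∃ (x y : (AlgebraicClosure ℚ))
      (h : (W₁.baseChange (AlgebraicClosure ℚ)).toAffine.Nonsingular x y), m = .some x y h ∧
      aeval (x + β₁) Q₀ ≠ 0 ∧ ∃ z, z ∉ L'.lattice ∧ jW₁ m = u₁ z := by
    intro m hm
    simp only [hBad, Set.mem_union, Set.mem_setOf_eq, not_or, not_exists, not_and] at hm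
    obtain ⟨z, hz⟩ := hsurj₁ (jW₁ m)
    have hzL' : z ∉ L'.lattice := by
      intro hzm
      obtain ⟨s, hs, hzs⟩ := (hS z).mp hzm
      apply hm.1
      refine ⟨s, hs, ?_⟩
      have h0 : u₁ (z - s) = 0 := (hu₁0 _).mpr hzs
      rw [map_sub, sub_eq_zero] at h0
      rw [← hz, h0]
    rcases m with _ | ⟨x, y, h⟩
    · exfalso
      apply hm.1
      refine ⟨0, hS0, ?_⟩
      rw [map_zero]
      exact (map_zero jW₁).symm
    · refine ⟨x, y, h, rfl, ?_, z, hzL', hz.symm⟩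
      rw [← hevalQ]
      exact hm.2 x y h rfl
  -- the `ℚ̄`-rational formula for `Φ` at good points
  have hformula : ∀ {x y : (AlgebraicClosure ℚ)} (hxy : (W₁.baseChange (AlgebraicClosure ℚ)).toAffine.Nonsingular x y) {z : ℂ},
      z ∉ L'.lattice → jW₁ (.some x y hxy) = u₁ z →
      ∃ h₂ : (W₂.baseChange (AlgebraicClosure ℚ)).toAffine.Nonsingular
        (((algebraMap ℚ (AlgebraicClosure ℚ) c)⁻¹ ^ 2 * aeval (x + algebraMap ℚ (AlgebraicClosure ℚ) W₁.b₂ / 12) P₀ -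
            algebraMap ℚ (AlgebraicClosure ℚ) W₂.b₂ / 12 * aeval (x + algebraMap ℚ (AlgebraicClosure ℚ) W₁.b₂ / 12) Q₀) /
          aeval (x + algebraMap ℚ (AlgebraicClosure ℚ) W₁.b₂ / 12) Q₀)
        (((algebraMap ℚ (AlgebraicClosure ℚ) c)⁻¹ ^ 3 *
              aeval (x + algebraMap ℚ (AlgebraicClosure ℚ) W₁.b₂ / 12) N₀ *
              (2 * y + algebraMap ℚ (AlgebraicClosure ℚ) W₁.a₁ * x + algebraMap ℚ (AlgebraicClosure ℚ) W₁.a₃) -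
            algebraMap ℚ (AlgebraicClosure ℚ) W₂.a₁ *
              ((algebraMap ℚ (AlgebraicClosure ℚ) c)⁻¹ ^ 2 * aeval (x + algebraMap ℚ (AlgebraicClosure ℚ) W₁.b₂ / 12) P₀ -
                algebraMap ℚ (AlgebraicClosure ℚ) W₂.b₂ / 12 * aeval (x + algebraMap ℚ (AlgebraicClosure ℚ) W₁.b₂ / 12) Q₀) *
              aeval (x + algebraMap ℚ (AlgebraicClosure ℚ) W₁.b₂ / 12) Q₀ -
            algebraMap ℚ (AlgebraicClosure ℚ) W₂.a₃ * aeval (x + algebraMap ℚ (AlgebraicClosure ℚ) W₁.b₂ / 12) Q₀ ^ 2) /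
          (2 * aeval (x + algebraMap ℚ (AlgebraicClosure ℚ) W₁.b₂ / 12) Q₀ ^ 2)),
      jW₂ (.some _ _ h₂) = Φ (jW₁ (.some x y hxy)) := by
    intro x y hxy z hzL' hz
    obtain ⟨h₂, hh₂⟩ := map_some_eq_uniformize_mul_of_transformation j hu₁ hu₂ hle hL' h℘ h℘'
      hQ hPQ hder hxy hzL' hz
    exact ⟨h₂, by rw [hz, hΦ]; exact hh₂⟩
  -- `Φ` preserves `j(W₁(ℚ̄))`
  have hpres : ∀ m : W₁.geomPoints, Φ (jW₁ m) ∈ jW₂.range := by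
    set T : AddSubgroup W₁.geomPoints := (jW₂.range.comap Φ).comap jW₁ with hT
    have hTtop : T = ⊤ := by
      refine AddSubgroup.eq_top_of_finite_compl T (hBadfin.subset fun m hm ↦ ?_)
      by_contra hmB
      apply hm
      obtain ⟨x, y, h, rfl, -, z, hzL', hz⟩ := hgood m hmB
      obtain ⟨h₂, hm₂⟩ := hformula h hzL' hz
      rw [hT, SetLike.mem_coe, AddSubgroup.mem_comap, AddSubgroup.mem_comap]
      exact ⟨_, hm₂⟩
    intro m
    have : m ∈ T := by rw [hTtop]; exact AddSubgroup.mem_top m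
    rw [hT, AddSubgroup.mem_comap, AddSubgroup.mem_comap] at this
    exact this
  -- the restriction `φ` of `Φ` along `j`
  set eR : W₂.geomPoints ≃+ jW₂.range := AddMonoidHom.ofInjective hj₂ with heR
  set φ : W₁.geomPoints →+ W₂.geomPoints :=
    eR.symm.toAddMonoidHom.comp ((Φ.comp jW₁).codRestrict jW₂.range fun m ↦ hpres m) with hφ
  have hfφ : ∀ m, jW₂ (φ m) = Φ (jW₁ m) := by
    intro m
    have h1 : ((eR (φ m) : jW₂.range) : (W₂.baseChange ℂ).toAffine.Point) = jW₂ (φ m) :=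
      AddMonoidHom.ofInjective_apply hj₂
    rw [← h1, hφ, AddMonoidHom.coe_comp, Function.comp_apply, AddEquiv.coe_toAddMonoidHom,
      AddEquiv.apply_symm_apply]
    rfl
  -- the value of `φ` at a good point
  have hφval : ∀ {x y : (AlgebraicClosure ℚ)} (hxy : (W₁.baseChange (AlgebraicClosure ℚ)).toAffine.Nonsingular x y) {z : ℂ},
      z ∉ L'.lattice → jW₁ (.some x y hxy) = u₁ z → ∃ h₂, φ (.some x y hxy) = .some
        (((algebraMap ℚ (AlgebraicClosure ℚ) c)⁻¹ ^ 2 * aeval (x + algebraMap ℚ (AlgebraicClosure ℚ) W₁.b₂ / 12) P₀ -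
            algebraMap ℚ (AlgebraicClosure ℚ) W₂.b₂ / 12 * aeval (x + algebraMap ℚ (AlgebraicClosure ℚ) W₁.b₂ / 12) Q₀) /
          aeval (x + algebraMap ℚ (AlgebraicClosure ℚ) W₁.b₂ / 12) Q₀)
        (((algebraMap ℚ (AlgebraicClosure ℚ) c)⁻¹ ^ 3 *
              aeval (x + algebraMap ℚ (AlgebraicClosure ℚ) W₁.b₂ / 12) N₀ *
              (2 * y + algebraMap ℚ (AlgebraicClosure ℚ) W₁.a₁ * x + algebraMap ℚ (AlgebraicClosure ℚ) W₁.a₃) -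
            algebraMap ℚ (AlgebraicClosure ℚ) W₂.a₁ *
              ((algebraMap ℚ (AlgebraicClosure ℚ) c)⁻¹ ^ 2 * aeval (x + algebraMap ℚ (AlgebraicClosure ℚ) W₁.b₂ / 12) P₀ -
                algebraMap ℚ (AlgebraicClosure ℚ) W₂.b₂ / 12 * aeval (x + algebraMap ℚ (AlgebraicClosure ℚ) W₁.b₂ / 12) Q₀) *
              aeval (x + algebraMap ℚ (AlgebraicClosure ℚ) W₁.b₂ / 12) Q₀ -
            algebraMap ℚ (AlgebraicClosure ℚ) W₂.a₃ * aeval (x + algebraMap ℚ (AlgebraicClosure ℚ) W₁.b₂ / 12) Q₀ ^ 2) /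
          (2 * aeval (x + algebraMap ℚ (AlgebraicClosure ℚ) W₁.b₂ / 12) Q₀ ^ 2)) h₂ := by
    intro x y hxy z hzL' hz
    obtain ⟨h₂, hm₂⟩ := hformula hxy hzL' hz
    exact ⟨h₂, hj₂ (by rw [hfφ, hm₂])⟩
  -- `φ` is algebraic
  have halg : IsAlgebraicOn W₁ W₂ φ := by
    set Tm : MvPolynomial (Fin 2) (AlgebraicClosure ℚ) := MvPolynomial.X 0 + MvPolynomial.C β₁ with hTm
    set κ : (AlgebraicClosure ℚ) := (algebraMap ℚ (AlgebraicClosure ℚ) c)⁻¹ with hκ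
    set Pm : MvPolynomial (Fin 2) (AlgebraicClosure ℚ) := MvPolynomial.C (κ ^ 2) * Polynomial.aeval Tm P₀ -
      MvPolynomial.C (algebraMap ℚ (AlgebraicClosure ℚ) W₂.b₂ / 12) * Polynomial.aeval Tm Q₀ with hPm
    refine ⟨Pm, Polynomial.aeval Tm Q₀,
      MvPolynomial.C (κ ^ 3) * Polynomial.aeval Tm N₀ *
          (MvPolynomial.C 2 * MvPolynomial.X 1 + MvPolynomial.C (algebraMap ℚ (AlgebraicClosure ℚ) W₁.a₁) *
            MvPolynomial.X 0 + MvPolynomial.C (algebraMap ℚ (AlgebraicClosure ℚ) W₁.a₃)) -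
        MvPolynomial.C (algebraMap ℚ (AlgebraicClosure ℚ) W₂.a₁) * Pm * Polynomial.aeval Tm Q₀ -
        MvPolynomial.C (algebraMap ℚ (AlgebraicClosure ℚ) W₂.a₃) * Polynomial.aeval Tm Q₀ ^ 2,
      MvPolynomial.C 2 * Polynomial.aeval Tm Q₀ ^ 2, hBadfin.subset fun m hm ↦ ?_⟩
    by_contra hmB
    apply hm
    obtain ⟨x, y, h, rfl, hQx, z, hzL', hz⟩ := hgood m hmB
    obtain ⟨h₂, hφm⟩ := hφval h hzL' hz
    have heQ : MvPolynomial.eval ![x, y] (Polynomial.aeval Tm Q₀) = aeval (x + β₁) Q₀ :=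
      eval_aeval_X_zero_add_C Q₀ β₁ x y
    have heP : MvPolynomial.eval ![x, y] (Polynomial.aeval Tm P₀) = aeval (x + β₁) P₀ :=
      eval_aeval_X_zero_add_C P₀ β₁ x y
    have heN : MvPolynomial.eval ![x, y] (Polynomial.aeval Tm N₀) =
        aeval (x + β₁) N₀ :=
      eval_aeval_X_zero_add_C _ β₁ x y
    refine ⟨x, y, h, rfl, ?_, ?_, ?_⟩
    · rw [heQ]; exact hQx
    · simp only [map_mul, map_pow, MvPolynomial.eval_C, heQ]
      exact mul_ne_zero two_ne_zero (pow_ne_zero 2 hQx)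
    · have hx₂ : MvPolynomial.eval ![x, y] Pm / MvPolynomial.eval ![x, y] (Polynomial.aeval Tm Q₀) =
          ((algebraMap ℚ (AlgebraicClosure ℚ) c)⁻¹ ^ 2 * aeval (x + algebraMap ℚ (AlgebraicClosure ℚ) W₁.b₂ / 12) P₀ -
            algebraMap ℚ (AlgebraicClosure ℚ) W₂.b₂ / 12 * aeval (x + algebraMap ℚ (AlgebraicClosure ℚ) W₁.b₂ / 12) Q₀) /
          aeval (x + algebraMap ℚ (AlgebraicClosure ℚ) W₁.b₂ / 12) Q₀ := by
        simp only [hPm, map_sub, map_mul, MvPolynomial.eval_C, heQ, heP, hκ, hβ₁]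
      have hy₂ : MvPolynomial.eval ![x, y]
            (MvPolynomial.C (κ ^ 3) * Polynomial.aeval Tm N₀ *
              (MvPolynomial.C 2 * MvPolynomial.X 1 + MvPolynomial.C (algebraMap ℚ (AlgebraicClosure ℚ) W₁.a₁) *
                MvPolynomial.X 0 + MvPolynomial.C (algebraMap ℚ (AlgebraicClosure ℚ) W₁.a₃)) -
            MvPolynomial.C (algebraMap ℚ (AlgebraicClosure ℚ) W₂.a₁) * Pm * Polynomial.aeval Tm Q₀ -
            MvPolynomial.C (algebraMap ℚ (AlgebraicClosure ℚ) W₂.a₃) * Polynomial.aeval Tm Q₀ ^ 2) /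
          MvPolynomial.eval ![x, y] (MvPolynomial.C 2 * Polynomial.aeval Tm Q₀ ^ 2) =
          ((algebraMap ℚ (AlgebraicClosure ℚ) c)⁻¹ ^ 3 *
              aeval (x + algebraMap ℚ (AlgebraicClosure ℚ) W₁.b₂ / 12) N₀ *
              (2 * y + algebraMap ℚ (AlgebraicClosure ℚ) W₁.a₁ * x + algebraMap ℚ (AlgebraicClosure ℚ) W₁.a₃) -
            algebraMap ℚ (AlgebraicClosure ℚ) W₂.a₁ *
              ((algebraMap ℚ (AlgebraicClosure ℚ) c)⁻¹ ^ 2 * aeval (x + algebraMap ℚ (AlgebraicClosure ℚ) W₁.b₂ / 12) P₀ -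
                algebraMap ℚ (AlgebraicClosure ℚ) W₂.b₂ / 12 * aeval (x + algebraMap ℚ (AlgebraicClosure ℚ) W₁.b₂ / 12) Q₀) *
              aeval (x + algebraMap ℚ (AlgebraicClosure ℚ) W₁.b₂ / 12) Q₀ -
            algebraMap ℚ (AlgebraicClosure ℚ) W₂.a₃ * aeval (x + algebraMap ℚ (AlgebraicClosure ℚ) W₁.b₂ / 12) Q₀ ^ 2) /
          (2 * aeval (x + algebraMap ℚ (AlgebraicClosure ℚ) W₁.b₂ / 12) Q₀ ^ 2) := by
        simp only [hPm, map_sub, map_mul, map_add, map_pow, MvPolynomial.eval_C, MvPolynomial.eval_X,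
          heQ, heP, heN, hκ, hβ₁, Matrix.cons_val_zero, Matrix.cons_val_one]
      refine ⟨by rw [hx₂, hy₂]; exact h₂, ?_⟩
      rw [hφm]
      exact Affine.Point.some.congr_simp _ _ hx₂.symm _ _ hy₂.symm _
  -- `φ` commutes with the Galois group
  have hequiv : ∀ (τ : Field.absoluteGaloisGroup ℚ) (P : W₁.geomPoints), φ (τ • P) = τ • φ P := by
    intro τ
    -- `τ` as an algebra endomorphism of `ℚ̄`, and its action on points
    let τ' : (AlgebraicClosure ℚ) ≃ₐ[ℚ] (AlgebraicClosure ℚ) := τ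
    set τₕ : (AlgebraicClosure ℚ) →ₐ[ℚ] (AlgebraicClosure ℚ) := (τ' : (AlgebraicClosure ℚ) →ₐ[ℚ] (AlgebraicClosure ℚ)) with hτₕ
    have hτinj' : Function.Injective τₕ := fun a b hab ↦ τ'.injective hab
    have hsmul₂ : ∀ P : W₂.geomPoints, τ • P = Affine.Point.map τₕ P := fun _ ↦ rfl
    -- the two homomorphisms `P ↦ φ (τ P)` and `P ↦ τ (φ P)` agree off a finite set
    have hτinj : Function.Injective (fun P : W₁.geomPoints ↦ τ • P) := MulAction.injective τ
    have hfin : (Bad ∪ (fun P : W₁.geomPoints ↦ τ • P) ⁻¹' Bad).Finite :=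
      hBadfin.union (hBadfin.preimage hτinj.injOn)
    have heq : φ.comp (DistribSMul.toAddMonoidHom W₁.geomPoints τ) =
        (DistribSMul.toAddMonoidHom W₂.geomPoints τ).comp φ := by
      refine AddMonoidHom.eq_of_eqOn_compl_finite hfin fun P hP ↦ ?_
      simp only [Set.mem_union, Set.mem_preimage, not_or] at hP
      obtain ⟨x, y, h, rfl, -, z, hzL', hz⟩ := hgood P hP.1
      obtain ⟨x', y', h', hP', -, z', hzL'', hz'⟩ := hgood _ hP.2
      have hns : (W₁.baseChange (AlgebraicClosure ℚ)).toAffine.Nonsingular (τₕ x) (τₕ y) :=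
        (W₁.toAffine.baseChange_nonsingular hτinj' x y).mpr h
      have hτP : τ • (show W₁.geomPoints from Affine.Point.some x y h) =
          (show W₁.geomPoints from Affine.Point.some (τₕ x) (τₕ y) hns) := rfl
      rw [hτP] at hP' hz'
      obtain ⟨hx', hy'⟩ := Affine.Point.some.inj hP'
      subst hx' hy'
      obtain ⟨h₂, hφP⟩ := hφval h hzL' hz
      obtain ⟨h₂', hφP'⟩ := hφval hns hzL'' hz'
      show φ (τ • (show W₁.geomPoints from Affine.Point.some x y h)) =
        τ • φ (show W₁.geomPoints from Affine.Point.some x y h)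
      rw [hτP, hφP', hφP, hsmul₂]
      erw [Affine.Point.map_some]
      refine Affine.Point.some.congr_simp _ _ ?_ _ _ ?_ _
      · simp only [map_div₀, map_sub, map_mul, map_add, map_pow, map_inv₀, map_ofNat,
          AlgHom.commutes, ← Polynomial.aeval_algHom_apply]
      · simp only [map_div₀, map_sub, map_mul, map_add, map_pow, map_inv₀, map_ofNat,
          AlgHom.commutes, ← Polynomial.aeval_algHom_apply]
    intro P
    exact congrArg (fun g : W₁.geomPoints →+ W₂.geomPoints ↦ g P) heq
  -- the isogeny, and the `x`-coordinate formula repackaged over `ℚ[X]`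
  let ψ : Isogeny W₁ W₂ :=
    { toAddMonoidHom := φ
      isAlgebraic := halg
      equivariant := hequiv
      finite_ker := halg.finite_ker }
  set βq : ℚ := W₁.b₂ / 12 with hβq
  have hT1 : (X + C βq).natDegree = 1 := natDegree_X_add_C βq
  have hT0 : (X + C βq).natDegree ≠ 0 := by rw [hT1]; exact one_ne_zero
  have hBm : (Q₀.comp (X + C βq)).Monic := hQ₀m.comp (monic_X_add_C βq) hT0
  have hBdeg : (Q₀.comp (X + C βq)).natDegree = Q₀.natDegree := by
    rw [natDegree_comp, hT1, mul_one]
  have hPcdeg : (P₀.comp (X + C βq)).natDegree = Q₀.natDegree + 1 := by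
    rw [natDegree_comp, hT1, mul_one, hdegPQ]
  have hPclc : (P₀.comp (X + C βq)).leadingCoeff = 1 := by
    rw [leadingCoeff_comp hT0, hlcPQ, (monic_X_add_C βq).leadingCoeff, one_pow, one_mul]
  have hκ : (c⁻¹ ^ 2 : ℚ) ≠ 0 := pow_ne_zero 2 (inv_ne_zero hc)
  have h1deg : (C (c⁻¹ ^ 2) * P₀.comp (X + C βq)).natDegree = Q₀.natDegree + 1 := by
    rw [natDegree_C_mul hκ, hPcdeg]
  have h1lc : (C (c⁻¹ ^ 2) * P₀.comp (X + C βq)).leadingCoeff = c⁻¹ ^ 2 := by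
    rw [leadingCoeff_mul, leadingCoeff_C, hPclc, mul_one]
  have h2deg : (C (W₂.b₂ / 12) * Q₀.comp (X + C βq)).natDegree < Q₀.natDegree + 1 :=
    lt_of_le_of_lt (natDegree_C_mul_le _ _) (by rw [hBdeg]; exact Nat.lt_succ_self _)
  have hAdeg : (C (c⁻¹ ^ 2) * P₀.comp (X + C βq) -
      C (W₂.b₂ / 12) * Q₀.comp (X + C βq)).natDegree = Q₀.natDegree + 1 := by
    rw [natDegree_sub_eq_left_of_natDegree_lt (h2deg.trans_eq h1deg.symm), h1deg]
  have hAlc : (C (c⁻¹ ^ 2) * P₀.comp (X + C βq) -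
      C (W₂.b₂ / 12) * Q₀.comp (X + C βq)).leadingCoeff = c⁻¹ ^ 2 := by
    rw [leadingCoeff_sub_of_degree_lt (degree_lt_degree (h2deg.trans_eq h1deg.symm)), h1lc]
  have hβ : ∀ x : AlgebraicClosure ℚ, aeval x (X + C βq) = x + β₁ := fun x ↦ by
    rw [hβ₁, hβq, map_add, aeval_X, aeval_C, map_div₀, map_ofNat]
  have hB : ∀ x : AlgebraicClosure ℚ, aeval x (Q₀.comp (X + C βq)) = aeval (x + β₁) Q₀ :=
    fun x ↦ by rw [aeval_comp, hβ]
  have hA : ∀ x : AlgebraicClosure ℚ,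
      aeval x (C (c⁻¹ ^ 2) * P₀.comp (X + C βq) - C (W₂.b₂ / 12) * Q₀.comp (X + C βq)) =
        (algebraMap ℚ (AlgebraicClosure ℚ) c)⁻¹ ^ 2 * aeval (x + β₁) P₀ -
          algebraMap ℚ (AlgebraicClosure ℚ) W₂.b₂ / 12 * aeval (x + β₁) Q₀ := fun x ↦ by
    rw [map_sub, map_mul, map_mul, aeval_C, aeval_C, aeval_comp, aeval_comp, hβ, map_pow,
      map_inv₀, map_div₀, map_ofNat]
  refine ⟨ψ, C (c⁻¹ ^ 2) * P₀.comp (X + C βq) - C (W₂.b₂ / 12) * Q₀.comp (X + C βq),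
    Q₀.comp (X + C βq), Bad, hBadfin, hBm, by rw [hBdeg]; exact hAdeg, hAlc, ?_⟩
  intro x y h hm
  obtain ⟨x', y', h', hP', hQx, z, hzL', hz⟩ := hgood _ hm
  obtain ⟨hx', hy'⟩ := Affine.Point.some.inj hP'
  subst hx' hy'
  obtain ⟨h₂, hφm⟩ := hφval h hzL' hz
  rw [hA x, hB x]
  exact ⟨hQx, _, h₂, hφm⟩

/-! ### Specialisation to the hypotheses of the fact, and the reduction to the finite places -/

/-- **The rational scaling of `integral_neronScaling_of_isGloballyMinimal` is the multiplier of a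
`ℚ`-isogeny.** In the setting of the named fact
`Literature.NumberTheory.EllipticCurves.integral_neronScaling_of_isGloballyMinimal` — elliptic
`W₀, W'/ℚ` (minimality is not needed here) with Néron-type period pairs `L₀, L'`
(`IsNeronLatticeOf`) and `q ∈ ℚ`, `q ≠ 0`, with `qΛ₀ ⊆ Λ'` — there is a `ℚ`-isogeny
`φ : W₀ → W'` whose `x`-coordinate off a finite set of `ℚ̄`-points is `A(x)/B(x)`, `A, B ∈ ℚ[X]`,
`B` monic, `deg A = deg B + 1`, `lc A = q⁻²` (so `φ^*ω' = ±q·ω₀` for the invariant differentials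
`ω = dx/(2y + a₁x + a₃)` of the two models; Silverman, *AEC*, Thm. VI.4.1(b), III.5). This is
`exists_isogeny_x_eq_of_forall_mul_mem_lattice` with the `IsNeronLatticeOf` hypotheses unpacked.
[cite: SilvermanAEC2009, Thm. VI.4.1] -/
theorem exists_isogeny_x_eq_of_isNeronLatticeOf (W₀ W' : WeierstrassCurve ℚ) [W₀.IsElliptic]
    {L₀ L' : PeriodPair} (hL₀ : ModularForms.IsNeronLatticeOf (W₀.baseChange ℂ) L₀)
    (hL' : ModularForms.IsNeronLatticeOf (W'.baseChange ℂ) L') {q : ℚ} (hq : q ≠ 0)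
    (hle : ∀ z ∈ L₀.lattice, (q : ℂ) * z ∈ L'.lattice) :
    ∃ (φ : Isogeny W₀ W') (A B : ℚ[X]) (Bad : Set W₀.geomPoints), Bad.Finite ∧ B.Monic ∧
      A.natDegree = B.natDegree + 1 ∧ A.leadingCoeff = q⁻¹ ^ 2 ∧
      ∀ (x y : AlgebraicClosure ℚ)
        (h : (W₀.baseChange (AlgebraicClosure ℚ)).toAffine.Nonsingular x y),
        (Affine.Point.some x y h : W₀.geomPoints) ∉ Bad →
        aeval x B ≠ 0 ∧ ∃ (y₂ : AlgebraicClosure ℚ)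
          (h₂ : (W'.baseChange (AlgebraicClosure ℚ)).toAffine.Nonsingular (aeval x A / aeval x B) y₂),
          φ (Affine.Point.some x y h) = Affine.Point.some (aeval x A / aeval x B) y₂ h₂ :=
  exists_isogeny_x_eq_of_forall_mul_mem_lattice hL₀.1 hL₀.2 hL'.1 hL'.2 hq hle

/-- **Reduction of `integral_neronScaling_of_isGloballyMinimal` to its finite-place half.** The
named fact follows from the following purely algebraic statement about `ℚ`-isogenies between
GLOBALLY MINIMAL models (hypothesis `hInt`, "integral Néron multipliers in coordinates"): *if a
`ℚ`-isogeny `φ : W₀ → W'` has `x`-coordinate `A(x)/B(x)` off a finite set of `ℚ̄`-points with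
`A, B ∈ ℚ[X]`, `B` monic, `deg A = deg B + 1` and `lc A = r⁻²` for some `r ∈ ℚˣ`, then `r ∈ ℤ`*
— i.e. `φ^*ω' = ±r·ω₀` for the Néron differentials forces `r ∈ ℤ`, which is the Néron mapping
property read on invariant differentials (Silverman, *ATAEC*, IV.5 with Thm. IV.6.1 and
Cor. IV.9.1: `φ` extends to the Néron models and the invariant differentials of the Néron model
of a globally minimal `W₀` are `ℤ·ω₀`). `hInt` is NOT proved in the tree (no Néron models or
reduction theory attached to the tree's point-set isogenies); it enters as an explicit
hypothesis schema, exactly as the finite-place input `(D)` of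
`WeierstrassCurve.stableFaltingsHeight_le_of_isogeny_of_finitePart`. Given `hInt`: `q = 0` is
the integer `0`, and for `q ≠ 0` apply `hInt` to the isogeny of
`exists_isogeny_x_eq_of_isNeronLatticeOf` with `r = q`.
[cite: SilvermanATAEC1994, IV.5 (Néron mapping property) with Thm. IV.6.1 and Cor. IV.9.1] -/
theorem integral_neronScaling_of_isGloballyMinimal_of_integral_multiplier
    (hInt : ∀ (W₀ W' : WeierstrassCurve ℚ) [W₀.IsElliptic] [W'.IsElliptic] [W₀.IsGloballyMinimal]
      [W'.IsGloballyMinimal] (φ : Isogeny W₀ W') (A B : ℚ[X]) (Bad : Set W₀.geomPoints) (r : ℚ),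
      r ≠ 0 → Bad.Finite → B.Monic → A.natDegree = B.natDegree + 1 → A.leadingCoeff = r⁻¹ ^ 2 →
      (∀ (x y : AlgebraicClosure ℚ)
        (h : (W₀.baseChange (AlgebraicClosure ℚ)).toAffine.Nonsingular x y),
        (Affine.Point.some x y h : W₀.geomPoints) ∉ Bad →
        aeval x B ≠ 0 ∧ ∃ (y₂ : AlgebraicClosure ℚ)
          (h₂ : (W'.baseChange (AlgebraicClosure ℚ)).toAffine.Nonsingular (aeval x A / aeval x B) y₂),
          φ (Affine.Point.some x y h) = Affine.Point.some (aeval x A / aeval x B) y₂ h₂) →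
      ∃ k : ℤ, (k : ℚ) = r) :
    integral_neronScaling_of_isGloballyMinimal := by
  intro W₀ W' _ _ _ _ L₀ L' hL₀ hL' q hle
  by_cases hq : q = 0
  · exact ⟨0, by rw [hq, Int.cast_zero]⟩
  · obtain ⟨φ, A, B, Bad, hBad, hBm, hdeg, hlc, hφ⟩ :=
      exists_isogeny_x_eq_of_isNeronLatticeOf W₀ W' hL₀ hL' hq hle
    exact hInt W₀ W' φ A B Bad q hq hBad hBm hdeg hlc hφ

end Literature.NumberTheory.EllipticCurves

end
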